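import Summits.BirchSwinnertonDyer.BirchSwinnertonDyer.Theorems.ManinLocalTwoThreeCDivisionTranslates
import HarnessLib

/-!
# The three SIGN COMBINATIONS of the translates of the `c`-division witness: `A = F₀ + F_α − F_β − F_γ`
(route `ManinLocalTwoThree`, crux C2 `ManinOddAtFour` stmt-BirchSwinnertonDyer-22967; cell bsd-f2-manin, prover p3 gen 19; brick 3 of the kernel
port of E-an-152d in the `2 ∣ c₀` form: index `4` ∧ `|c₀| = 2` ⟹ full rational `2`-torsion)

In the index-`4` configuration `Λ₀(f)/Λ_W ≅ (ℤ/2)²` has the four classes `0, α, β, γ` (`α + β ≡ γ`).  For the translate family `F_w`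
(`…CDivisionTranslates.exists_translateFamily`) the combination `A = F₀ + F_α − F_β − F_γ` is an EIGENFUNCTION of `Γ₀(N)`:
`A ∣ δ = s({∞,δ∞}_f)·A` with the sign `s(w) = +1` on the classes `0, α` and `−1` on `β, γ` — a quadratic character of `Γ₀(N)` trivial on `Γ₁(N)`.
* `slash_combination` — the eigen-relation (four cases on the class of `{∞,δ∞}_f`);
* `sign_add` — `s(w + w') = s(w)s(w')` on `Λ₀(f)` (the kernel `Λ_W ∪ (α + Λ_W)` has index `2`);
* `exists_combination_ne_zero` — `A ≢ 0` arbitrarily high in the cusp (`|℘(ℰ_f)| → ∞`, the translates stay bounded, `G ≢ 0`);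
* `exists_hasSum_combination` — the `q`-series of `A` high in the cusp: `g_F + 𝒮 e_α − 𝒮 e_β − 𝒮 e_γ`.
HONEST FRAMING: analytic bookkeeping; E-an-152d, C2, Manin's conjecture and BSD are NOT proved here.  No definitions, no sorry.
[cite: Manin1972, Prop. 1.4] [cite: ShimuraIATAF1971, §2.4] [cite: Lawden1989, §6.8 eq. (6.8.11)]
-/

set_option autoImplicit false
-- lint-debt: the directory name repeats the summit name (sibling precedent `ManinLocalTwoThreeCDivisionTranslates.lean`)
set_option linter.dupNamespace false

noncomputable section

open scoped Topology PeriodPair MatrixGroups ModularForm Manifold Classical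
open Complex Filter PowerSeries CongruenceSubgroup
open UpperHalfPlane hiding I
open WeierstrassCurve Literature.NumberTheory.EllipticCurves Literature.NumberTheory.EllipticCurves.ModularForms

namespace Summit.BirchSwinnertonDyer.BirchSwinnertonDyer.Theorems.ManinLocalTwoThree.CDivTranslate

variable {N : ℕ} [NeZero N]

/-! ## §1 Class bookkeeping in `Λ₀(f)/Λ_W ≅ (ℤ/2)²` -/

section Classes

variable {W : WeierstrassCurve ℚ} (D : ModularParametrizationData W N)
  (h2 : ∀ w ∈ periodLattice D.f, 2 * w ∈ D.L.lattice)
  {α β γ : ℂ} (hα : α ∈ periodLattice D.f) (hβ : β ∈ periodLattice D.f) (hγ : γ ∈ periodLattice D.f)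
  (hαW : α ∉ D.L.lattice) (hβW : β ∉ D.L.lattice) (hγW : γ ∉ D.L.lattice)
  (hαβ : α - β ∉ D.L.lattice) (hαγ : α - γ ∉ D.L.lattice) (hβγ : β - γ ∉ D.L.lattice)
  (hsum : α + β - γ ∈ D.L.lattice)
  (hcover : ∀ w ∈ periodLattice D.f, w ∈ D.L.lattice ∨ w - α ∈ D.L.lattice ∨ w - β ∈ D.L.lattice ∨ w - γ ∈ D.L.lattice)

include h2 hα hβ hγ hsum in
/-- Derived class relations of the triple: `2α, 2β, 2γ, α + γ − β, β + γ − α ∈ Λ_W`. [folklore] -/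
theorem triple_relations :
    2 * α ∈ D.L.lattice ∧ 2 * β ∈ D.L.lattice ∧ 2 * γ ∈ D.L.lattice ∧
      α + γ - β ∈ D.L.lattice ∧ β + γ - α ∈ D.L.lattice := by
  refine ⟨h2 α hα, h2 β hβ, h2 γ hγ, ?_, ?_⟩
  · have e : α + γ - β = (α + β - γ) + 2 * γ - 2 * β := by ring
    rw [e]; exact sub_mem (add_mem hsum (h2 γ hγ)) (h2 β hβ)
  · have e : β + γ - α = 2 * β - (α + β - γ) := by ring
    rw [e]; exact sub_mem (h2 β hβ) hsum

include hβW hγW hαβ hαγ in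
/-- The kernel classes `0, α` are disjoint from the classes `β, γ`. [folklore] -/
theorem not_mem_kernel_of_mem_βγ {w : ℂ} (hw : w - β ∈ D.L.lattice ∨ w - γ ∈ D.L.lattice) :
    ¬ (w ∈ D.L.lattice ∨ w - α ∈ D.L.lattice) := by
  rintro (h | h)
  · rcases hw with hw | hw
    · exact hβW (by have := sub_mem h hw; rwa [sub_sub_cancel] at this)
    · exact hγW (by have := sub_mem h hw; rwa [sub_sub_cancel] at this)
  · rcases hw with hw | hw
    · exact hαβ (by have := sub_mem hw h; have e : w - β - (w - α) = α - β := (by ring); rwa [e] at this)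
    · exact hαγ (by have := sub_mem hw h; have e : w - γ - (w - α) = α - γ := (by ring); rwa [e] at this)

include h2 hα hβ hγ hβW hγW hαβ hαγ hsum hcover in
/-- **The sign is a character**: with `s(w) = 1` on `Λ_W ∪ (α + Λ_W)` and `−1` on `(β + Λ_W) ∪ (γ + Λ_W)`,
`s(w + w') = s(w)·s(w')` for `w, w' ∈ Λ₀(f)` (the kernel has index `2`). [folklore] -/
theorem sign_add {w w' : ℂ} (hw : w ∈ periodLattice D.f) (hw' : w' ∈ periodLattice D.f) :
    (if (w + w') ∈ D.L.lattice ∨ (w + w') - α ∈ D.L.lattice then (1 : ℤ) else -1) =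
      (if w ∈ D.L.lattice ∨ w - α ∈ D.L.lattice then (1 : ℤ) else -1) *
        (if w' ∈ D.L.lattice ∨ w' - α ∈ D.L.lattice then (1 : ℤ) else -1) := by
  obtain ⟨h2α, h2β, _h2γ, _hαγβ, hβγα⟩ := triple_relations D h2 hα hβ hγ hsum
  -- membership in the kernel `M = Λ_W ∪ (α + Λ_W)` versus the complement `(β + Λ_W) ∪ (γ + Λ_W)`
  have hcompl : ∀ x ∈ periodLattice D.f, ¬ (x ∈ D.L.lattice ∨ x - α ∈ D.L.lattice) →
      (x - β ∈ D.L.lattice ∨ x - γ ∈ D.L.lattice) := by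
    intro x hx hxM
    rcases hcover x hx with h | h | h | h
    · exact absurd (Or.inl h) hxM
    · exact absurd (Or.inr h) hxM
    · exact Or.inl h
    · exact Or.inr h
  have hMM : ∀ x y : ℂ, (x ∈ D.L.lattice ∨ x - α ∈ D.L.lattice) → (y ∈ D.L.lattice ∨ y - α ∈ D.L.lattice) →
      ((x + y) ∈ D.L.lattice ∨ (x + y) - α ∈ D.L.lattice) := by
    rintro x y (hx | hx) (hy | hy)
    · exact Or.inl (add_mem hx hy)
    · exact Or.inr (by have e : x + y - α = x + (y - α) := (by ring); rw [e]; exact add_mem hx hy)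
    · exact Or.inr (by have e : x + y - α = (x - α) + y := (by ring); rw [e]; exact add_mem hx hy)
    · exact Or.inl (by have e : x + y = (x - α) + (y - α) + 2 * α := (by ring); rw [e]; exact add_mem (add_mem hx hy) h2α)
  have hMC : ∀ x y : ℂ, (x ∈ D.L.lattice ∨ x - α ∈ D.L.lattice) → (y - β ∈ D.L.lattice ∨ y - γ ∈ D.L.lattice) →
      ((x + y) - β ∈ D.L.lattice ∨ (x + y) - γ ∈ D.L.lattice) := by
    rintro x y (hx | hx) (hy | hy)
    · exact Or.inl (by have e : x + y - β = x + (y - β) := (by ring); rw [e]; exact add_mem hx hy)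
    · exact Or.inr (by have e : x + y - γ = x + (y - γ) := (by ring); rw [e]; exact add_mem hx hy)
    · exact Or.inr (by have e : x + y - γ = (x - α) + (y - β) + (α + β - γ) := (by ring); rw [e]; exact add_mem (add_mem hx hy) hsum)
    · exact Or.inl (by
        have e : x + y - β = (x - α) + (y - γ) + (α + γ - β) := by ring
        rw [e]; exact add_mem (add_mem hx hy) _hαγβ)
  have hCC : ∀ x y : ℂ, (x - β ∈ D.L.lattice ∨ x - γ ∈ D.L.lattice) → (y - β ∈ D.L.lattice ∨ y - γ ∈ D.L.lattice) →
      ((x + y) ∈ D.L.lattice ∨ (x + y) - α ∈ D.L.lattice) := by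
    rintro x y (hx | hx) (hy | hy)
    · exact Or.inl (by have e : x + y = (x - β) + (y - β) + 2 * β := (by ring); rw [e]; exact add_mem (add_mem hx hy) h2β)
    · exact Or.inr (by have e : x + y - α = (x - β) + (y - γ) + (β + γ - α) := (by ring); rw [e]; exact add_mem (add_mem hx hy) hβγα)
    · exact Or.inr (by have e : x + y - α = (x - γ) + (y - β) + (β + γ - α) := (by ring); rw [e]; exact add_mem (add_mem hx hy) hβγα)
    · exact Or.inl (by have e : x + y = (x - γ) + (y - γ) + 2 * γ := (by ring); rw [e]; exact add_mem (add_mem hx hy) _h2γ)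
  have hne : ∀ {x : ℂ}, (x - β ∈ D.L.lattice ∨ x - γ ∈ D.L.lattice) → ¬ (x ∈ D.L.lattice ∨ x - α ∈ D.L.lattice) :=
    fun hx ↦ not_mem_kernel_of_mem_βγ D hβW hγW hαβ hαγ hx
  by_cases hM : w ∈ D.L.lattice ∨ w - α ∈ D.L.lattice <;> by_cases hM' : w' ∈ D.L.lattice ∨ w' - α ∈ D.L.lattice
  · rw [if_pos hM, if_pos hM', if_pos (hMM w w' hM hM')]; norm_num
  · rw [if_pos hM, if_neg hM', if_neg (hne (hMC w w' hM (hcompl w' hw' hM')))]; norm_num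
  · rw [if_neg hM, if_pos hM', if_neg (hne (by rw [add_comm]; exact hMC w' w hM' (hcompl w hw hM)))]; norm_num
  · rw [if_neg hM, if_neg hM', if_pos (hCC w w' (hcompl w hw hM) (hcompl w' hw' hM'))]; norm_num

end Classes

/-! ## §2 The combination is an eigenfunction of `Γ₀(N)` -/

/-- **`A ∣ δ = s({∞,δ∞}_f)·A`** for `A = F₀ + F_α − F_β − F_γ`: translating the four classes by the class of `{∞,δ∞}_f` permutes the translates
(`F_w ∣ δ = F_{w + {∞,δ∞}}`, `F_w = F_{w'}` for `w ≡ w'`), fixing `A` on the kernel classes `0, α` and negating it on `β, γ`. [cite: Manin1972, Prop. 1.4] -/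
theorem slash_combination {W : WeierstrassCurve ℚ} (D : ModularParametrizationData W N) {K : ℤ} (Fw : ℂ → ℍ → ℂ)
    (hT3 : ∀ w ∈ periodLattice D.f, ∀ δ : Gamma0 N, Fw w ∣[K] (δ : SL(2, ℤ)) = Fw (w + cuspSymbol D.f δ))
    (hT4 : ∀ w ∈ periodLattice D.f, ∀ w' ∈ periodLattice D.f, w - w' ∈ D.L.lattice → Fw w = Fw w')
    (h2 : ∀ w ∈ periodLattice D.f, 2 * w ∈ D.L.lattice)
    {α β γ : ℂ} (hα : α ∈ periodLattice D.f) (hβ : β ∈ periodLattice D.f) (hγ : γ ∈ periodLattice D.f)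
    (hβW : β ∉ D.L.lattice) (hγW : γ ∉ D.L.lattice) (hαβ : α - β ∉ D.L.lattice) (hαγ : α - γ ∉ D.L.lattice)
    (hsum : α + β - γ ∈ D.L.lattice)
    (hcover : ∀ w ∈ periodLattice D.f, w ∈ D.L.lattice ∨ w - α ∈ D.L.lattice ∨ w - β ∈ D.L.lattice ∨ w - γ ∈ D.L.lattice)
    (δ : Gamma0 N) :
    (Fw 0 + Fw α - Fw β - Fw γ) ∣[K] (δ : SL(2, ℤ)) =
      ((if cuspSymbol D.f δ ∈ D.L.lattice ∨ cuspSymbol D.f δ - α ∈ D.L.lattice then (1 : ℤ) else -1 : ℤ) : ℂ) •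
        (Fw 0 + Fw α - Fw β - Fw γ) := by
  obtain ⟨h2α, h2β, h2γ, hαγβ, hβγα⟩ := triple_relations D h2 hα hβ hγ hsum
  have hpΛ : cuspSymbol D.f δ ∈ periodLattice D.f := AddSubgroup.subset_closure ⟨δ, rfl⟩
  have h0 : (0 : ℂ) ∈ periodLattice D.f := zero_mem _
  -- distribute the slash
  have hdist : (Fw 0 + Fw α - Fw β - Fw γ) ∣[K] (δ : SL(2, ℤ)) =
      Fw (0 + cuspSymbol D.f δ) + Fw (α + cuspSymbol D.f δ) - Fw (β + cuspSymbol D.f δ) - Fw (γ + cuspSymbol D.f δ) := by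
    rw [← hT3 0 h0 δ, ← hT3 α hα δ, ← hT3 β hβ δ, ← hT3 γ hγ δ]
    simp only [sub_eq_add_neg, SlashAction.add_slash, SlashAction.neg_slash]
  rw [hdist]
  have hne : ∀ {x : ℂ}, (x - β ∈ D.L.lattice ∨ x - γ ∈ D.L.lattice) → ¬ (x ∈ D.L.lattice ∨ x - α ∈ D.L.lattice) :=
    fun hx ↦ not_mem_kernel_of_mem_βγ D hβW hγW hαβ hαγ hx
  rcases hcover (cuspSymbol D.f δ) hpΛ with h | h | h | h
  · -- class `0`
    rw [if_pos (Or.inl h), hT4 _ (add_mem h0 hpΛ) 0 h0 (by simpa using h), hT4 _ (add_mem hα hpΛ) α hα (by simpa using h),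
      hT4 _ (add_mem hβ hpΛ) β hβ (by simpa using h), hT4 _ (add_mem hγ hpΛ) γ hγ (by simpa using h)]
    simp
  · -- class `α`
    rw [if_pos (Or.inr h), hT4 _ (add_mem h0 hpΛ) α hα (by simpa using h),
      hT4 _ (add_mem hα hpΛ) 0 h0 (by have e : α + cuspSymbol D.f δ - 0 = (cuspSymbol D.f δ - α) + 2 * α := (by ring); rw [e]; exact add_mem h h2α),
      hT4 _ (add_mem hβ hpΛ) γ hγ (by have e : β + cuspSymbol D.f δ - γ = (cuspSymbol D.f δ - α) + (α + β - γ) := (by ring); rw [e]; exact add_mem h hsum),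
      hT4 _ (add_mem hγ hpΛ) β hβ (by have e : γ + cuspSymbol D.f δ - β = (cuspSymbol D.f δ - α) + (α + γ - β) := (by ring); rw [e]; exact add_mem h hαγβ)]
    simp only [Int.cast_one, one_smul]
    abel
  · -- class `β`
    rw [if_neg (hne (Or.inl h)), hT4 _ (add_mem h0 hpΛ) β hβ (by simpa using h),
      hT4 _ (add_mem hα hpΛ) γ hγ (by have e : α + cuspSymbol D.f δ - γ = (cuspSymbol D.f δ - β) + (α + β - γ) := (by ring); rw [e]; exact add_mem h hsum),
      hT4 _ (add_mem hβ hpΛ) 0 h0 (by have e : β + cuspSymbol D.f δ - 0 = (cuspSymbol D.f δ - β) + 2 * β := (by ring); rw [e]; exact add_mem h h2β),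
      hT4 _ (add_mem hγ hpΛ) α hα (by have e : γ + cuspSymbol D.f δ - α = (cuspSymbol D.f δ - β) + (β + γ - α) := (by ring); rw [e]; exact add_mem h hβγα)]
    simp only [Int.reduceNeg, Int.cast_neg, Int.cast_one, _root_.neg_smul, one_smul]
    abel
  · -- class `γ`
    rw [if_neg (hne (Or.inr h)), hT4 _ (add_mem h0 hpΛ) γ hγ (by simpa using h),
      hT4 _ (add_mem hα hpΛ) β hβ (by have e : α + cuspSymbol D.f δ - β = (cuspSymbol D.f δ - γ) + (α + γ - β) := (by ring); rw [e]; exact add_mem h hαγβ),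
      hT4 _ (add_mem hβ hpΛ) α hα (by have e : β + cuspSymbol D.f δ - α = (cuspSymbol D.f δ - γ) + (β + γ - α) := (by ring); rw [e]; exact add_mem h hβγα),
      hT4 _ (add_mem hγ hpΛ) 0 h0 (by have e : γ + cuspSymbol D.f δ - 0 = (cuspSymbol D.f δ - γ) + 2 * γ := (by ring); rw [e]; exact add_mem h h2γ)]
    simp only [Int.reduceNeg, Int.cast_neg, Int.cast_one, _root_.neg_smul, one_smul]
    abel

/-! ## §3 The combination does not vanish identically high in the cusp -/

/-- **`A ≢ 0` high in the cusp.**  With the presentation `F_w = 12℘_{Λ_W}(ℰ_f + w)·G·Δ^a` (`w ∈ {0, α, β, γ}`, `α, β, γ ∉ Λ_W`): since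
`|℘_{Λ_W}(ℰ_f τ)| → ∞` while `℘_{Λ_W}(ℰ_f τ + w) → ℘_{Λ_W}(w)` for `w ∉ Λ_W`, and the nonzero cusp form `G` does not vanish identically near any point,
for every `B` there is `τ` with `Im τ > B` and `A(τ) ≠ 0`. [folklore] -/
theorem exists_combination_ne_zero {W : WeierstrassCurve ℚ} (D : ModularParametrizationData W N) {a : ℕ} {k : ℤ}
    (G : CuspForm (Gamma0 N) k) (hG0 : G ≠ 0) (Fw : ℂ → ℍ → ℂ)
    (hpres : ∀ w ∈ periodLattice D.f, ∀ τ : ℍ, eichlerIntegral D.f τ + w ∉ D.L.lattice →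
      Fw w τ = 12 * ℘[D.L] (eichlerIntegral D.f τ + w) * G τ * ModularForm.discriminant τ ^ a)
    {α β γ : ℂ} (hα : α ∈ periodLattice D.f) (hβ : β ∈ periodLattice D.f) (hγ : γ ∈ periodLattice D.f)
    (hαW : α ∉ D.L.lattice) (hβW : β ∉ D.L.lattice) (hγW : γ ∉ D.L.lattice) (B : ℝ) :
    ∃ τ : ℍ, B < τ.im ∧ (Fw 0 + Fw α - Fw β - Fw γ) τ ≠ 0 := by
  have hf : D.f ≠ 0 := D.isNewformOf.1.ne_zero
  have h0Λ : (0 : ℂ) ∈ periodLattice D.f := zero_mem _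
  -- `ℰ_f → 0`, so `ℰ_f + w → w ∉ Λ_W` and `℘(ℰ_f + w) → ℘(w)`; `|℘(ℰ_f)| → ∞`
  have hE0 : Tendsto (eichlerIntegral D.f) atImInfty (𝓝 0) := (isCuspFunction_eichlerIntegral D.f).isZeroAtImInfty
  have hcont : ∀ w : ℂ, w ∉ D.L.lattice →
      Tendsto (fun τ : ℍ ↦ ℘[D.L] (eichlerIntegral D.f τ + w)) atImInfty (𝓝 (℘[D.L] w)) ∧
      ∀ᶠ τ : ℍ in atImInfty, eichlerIntegral D.f τ + w ∉ D.L.lattice := by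
    intro w hw
    have hadd : Tendsto (fun τ : ℍ ↦ eichlerIntegral D.f τ + w) atImInfty (𝓝 w) := by
      simpa using hE0.add_const w
    refine ⟨((D.L.analyticOnNhd_weierstrassP w hw).continuousAt.tendsto).comp hadd, ?_⟩
    have ho : IsOpen ((D.L.lattice : Set ℂ)ᶜ) := D.L.isClosed_lattice.isOpen_compl
    exact hadd.eventually (ho.mem_nhds hw)
  have hbig := tendsto_norm_weierstrassP_eichlerIntegral_atTop D.f hf D.L
  obtain ⟨T₁, hT₁⟩ := exists_forall_eichlerIntegral_smul_notMem D.f hf D.L 1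
  set M : ℝ := ‖℘[D.L] α‖ + ‖℘[D.L] β‖ + ‖℘[D.L] γ‖ + 3 with hM
  have hev : ∀ᶠ τ : ℍ in atImInfty, M < ‖℘[D.L] (eichlerIntegral D.f τ)‖ ∧
      ‖℘[D.L] (eichlerIntegral D.f τ + α)‖ < ‖℘[D.L] α‖ + 1 ∧ ‖℘[D.L] (eichlerIntegral D.f τ + β)‖ < ‖℘[D.L] β‖ + 1 ∧
      ‖℘[D.L] (eichlerIntegral D.f τ + γ)‖ < ‖℘[D.L] γ‖ + 1 ∧
      eichlerIntegral D.f τ + α ∉ D.L.lattice ∧ eichlerIntegral D.f τ + β ∉ D.L.lattice ∧ eichlerIntegral D.f τ + γ ∉ D.L.lattice := by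
    have hn : ∀ w : ℂ, w ∉ D.L.lattice → ∀ᶠ τ : ℍ in atImInfty, ‖℘[D.L] (eichlerIntegral D.f τ + w)‖ < ‖℘[D.L] w‖ + 1 := by
      intro w hw
      have := ((hcont w hw).1.norm).eventually (eventually_lt_nhds (lt_add_one ‖℘[D.L] w‖))
      exact this
    filter_upwards [hbig.eventually (eventually_gt_atTop M), hn α hαW, hn β hβW, hn γ hγW,
      (hcont α hαW).2, (hcont β hβW).2, (hcont γ hγW).2] with τ h1 h2 h3 h4 h5 h6 h7
    exact ⟨h1, h2, h3, h4, h5, h6, h7⟩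
  obtain ⟨T₂, hT₂⟩ := (atImInfty_mem _).mp hev
  -- a point high in the cusp where `G ≠ 0`
  set B' : ℝ := max (max (max B T₁) T₂) 0 + 1 with hB'
  have hB'pos : 0 < B' := by
    have : (0 : ℝ) ≤ max (max (max B T₁) T₂) 0 := le_max_right _ _
    linarith
  obtain ⟨τ, hτB, hGτ⟩ : ∃ τ : ℍ, B' - 1 < τ.im ∧ G τ ≠ 0 := by
    by_contra hcon
    push Not at hcon
    set z : ℂ := (B' : ℂ) * Complex.I with hz
    have hzim : z.im = B' := by simp [hz]
    have hzpos : 0 < z.im := by rw [hzim]; exact hB'pos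
    have hopen : ∀ᶠ w in 𝓝 z, B' - 1 < w.im := by
      have ho : IsOpen {w : ℂ | B' - 1 < w.im} := isOpen_lt continuous_const Complex.continuous_im
      exact ho.mem_nhds (by show B' - 1 < z.im; rw [hzim]; linarith)
    have hB'1 : 0 ≤ B' - 1 := by
      have : (0 : ℝ) ≤ max (max (max B T₁) T₂) 0 := le_max_right _ _
      linarith
    have hzero : ∀ᶠ w in 𝓝 z, (⇑G ∘ ofComplex) w = 0 := by
      filter_upwards [hopen] with w hw
      have hwpos : 0 < w.im := by linarith
      rw [Function.comp_apply, ofComplex_apply_of_im_pos hwpos]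
      exact hcon ⟨w, hwpos⟩ hw
    have h := IsXPresentation.modularForm_eq_zero_of_eventuallyEq_zero (G := (G : ModularForm (Gamma0 N) k)) hzpos hzero
    refine hG0 (DFunLike.ext _ _ fun τ' ↦ ?_)
    have := DFunLike.congr_fun h τ'
    simpa using this
  have hτT₂ : T₂ ≤ τ.im := by
    have : T₂ ≤ B' - 1 := by
      simp only [hB', add_sub_cancel_right]
      exact (le_max_right _ _).trans (le_max_left _ _)
    linarith
  have hτT₁ : T₁ ≤ τ.im := by
    have : T₁ ≤ B' - 1 := by
      simp only [hB', add_sub_cancel_right]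
      exact ((le_max_right _ _).trans (le_max_left _ _)).trans (le_max_left _ _)
    linarith
  have hτB' : B < τ.im := by
    have : B ≤ B' - 1 := by
      simp only [hB', add_sub_cancel_right]
      exact ((le_max_left _ _).trans (le_max_left _ _)).trans (le_max_left _ _)
    linarith
  obtain ⟨h1, h2', h3, h4, h5, h6, h7⟩ := hT₂ τ hτT₂
  have hE : eichlerIntegral D.f τ ∉ D.L.lattice := by simpa using hT₁ τ hτT₁
  refine ⟨τ, hτB', ?_⟩
  -- the value of `A τ`
  have hv : (Fw 0 + Fw α - Fw β - Fw γ) τ =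
      12 * (℘[D.L] (eichlerIntegral D.f τ) + ℘[D.L] (eichlerIntegral D.f τ + α) - ℘[D.L] (eichlerIntegral D.f τ + β)
        - ℘[D.L] (eichlerIntegral D.f τ + γ)) * G τ * ModularForm.discriminant τ ^ a := by
    simp only [Pi.add_apply, Pi.sub_apply]
    rw [hpres 0 h0Λ τ (by simpa using hE), hpres α hα τ h5, hpres β hβ τ h6, hpres γ hγ τ h7, add_zero]
    ring
  rw [hv]
  refine mul_ne_zero (mul_ne_zero (mul_ne_zero (by norm_num) ?_) hGτ) (pow_ne_zero _ (ModularForm.discriminant_ne_zero τ))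
  intro h0
  have hbound : ‖℘[D.L] (eichlerIntegral D.f τ)‖ ≤ ‖℘[D.L] (eichlerIntegral D.f τ + α)‖ + ‖℘[D.L] (eichlerIntegral D.f τ + β)‖ +
      ‖℘[D.L] (eichlerIntegral D.f τ + γ)‖ := by
    have e : ℘[D.L] (eichlerIntegral D.f τ) = -℘[D.L] (eichlerIntegral D.f τ + α) + ℘[D.L] (eichlerIntegral D.f τ + β)
        + ℘[D.L] (eichlerIntegral D.f τ + γ) := by linear_combination h0
    rw [e]
    refine (norm_add_le _ _).trans (add_le_add ((norm_add_le _ _).trans (add_le_add (by rw [norm_neg]) le_rfl)) le_rfl)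
  have : M < ‖℘[D.L] α‖ + ‖℘[D.L] β‖ + ‖℘[D.L] γ‖ + 3 := by linarith
  rw [hM] at this
  exact lt_irrefl _ this

/-! ## §4 The `q`-series of the combination high in the cusp -/

/-- **The series of `A = F₀ + F_α − F_β − F_γ`**: `Σ (g_F + 𝒮 e_α − 𝒮 e_β − 𝒮 e_γ)ₙ 𝕢ⁿ = A` high in the cusp (from the series of the translates).
[folklore] -/
theorem exists_hasSum_combination {W : WeierstrassCurve ℚ} (D : ModularParametrizationData W N) (Fw : ℂ → ℍ → ℂ) (gF : ℚ⟦X⟧) (𝒮 : ℂ → ℂ⟦X⟧)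
    (hF0 : ∃ B : ℝ, ∀ τ : ℍ, B < τ.im → eichlerIntegral D.f τ ∉ D.L.lattice ∧ ∀ w ∈ periodLattice D.f, w ∈ D.L.lattice →
      HasSum (fun n : ℕ ↦ ((coeff n gF : ℚ) : ℂ) * Function.Periodic.qParam 1 (τ : ℂ) ^ n) (Fw w τ))
    (hFw : ∀ w ∈ periodLattice D.f, w ∉ D.L.lattice → 2 * w ∈ D.L.lattice → ∃ B : ℝ, ∀ τ : ℍ, B < τ.im →
      eichlerIntegral D.f τ + w ∉ D.L.lattice ∧
      HasSum (fun n : ℕ ↦ coeff n (𝒮 (℘[D.L] w)) * Function.Periodic.qParam 1 (τ : ℂ) ^ n) (Fw w τ))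
    (h2 : ∀ w ∈ periodLattice D.f, 2 * w ∈ D.L.lattice)
    {α β γ : ℂ} (hα : α ∈ periodLattice D.f) (hβ : β ∈ periodLattice D.f) (hγ : γ ∈ periodLattice D.f)
    (hαW : α ∉ D.L.lattice) (hβW : β ∉ D.L.lattice) (hγW : γ ∉ D.L.lattice) :
    ∃ B : ℝ, ∀ τ : ℍ, B < τ.im →
      HasSum (fun n : ℕ ↦ coeff n (gF.map (algebraMap ℚ ℂ) + 𝒮 (℘[D.L] α) - 𝒮 (℘[D.L] β) - 𝒮 (℘[D.L] γ)) *
        Function.Periodic.qParam 1 (τ : ℂ) ^ n) ((Fw 0 + Fw α - Fw β - Fw γ) τ) := by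
  obtain ⟨B₀, hB₀⟩ := hF0
  obtain ⟨Bα, hBα⟩ := hFw α hα hαW (h2 α hα)
  obtain ⟨Bβ, hBβ⟩ := hFw β hβ hβW (h2 β hβ)
  obtain ⟨Bγ, hBγ⟩ := hFw γ hγ hγW (h2 γ hγ)
  refine ⟨max (max B₀ Bα) (max Bβ Bγ), fun τ hτ ↦ ?_⟩
  have hB₀' : B₀ < τ.im := lt_of_le_of_lt (le_trans (le_max_left _ _) (le_max_left _ _)) hτ
  have h0 := (hB₀ τ hB₀').2 0 (zero_mem _) (zero_mem _)
  have hα' := (hBα τ (lt_of_le_of_lt (le_trans (le_max_right _ _) (le_max_left _ _)) hτ)).2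
  have hβ' := (hBβ τ (lt_of_le_of_lt (le_trans (le_max_left _ _) (le_max_right _ _)) hτ)).2
  have hγ' := (hBγ τ (lt_of_le_of_lt (le_trans (le_max_right _ _) (le_max_right _ _)) hτ)).2
  have h0' : HasSum (fun n : ℕ ↦ coeff n (gF.map (algebraMap ℚ ℂ)) * Function.Periodic.qParam 1 (τ : ℂ) ^ n) (Fw 0 τ) := by
    convert h0 using 2 with n
    rw [coeff_map]; rfl
  have h := ((h0'.add hα').sub hβ').sub hγ'
  have hfun : (fun n : ℕ ↦ coeff n (gF.map (algebraMap ℚ ℂ) + 𝒮 (℘[D.L] α) - 𝒮 (℘[D.L] β) - 𝒮 (℘[D.L] γ)) *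
      Function.Periodic.qParam 1 (τ : ℂ) ^ n) = fun n : ℕ ↦
      coeff n (gF.map (algebraMap ℚ ℂ)) * Function.Periodic.qParam 1 (τ : ℂ) ^ n +
        coeff n (𝒮 (℘[D.L] α)) * Function.Periodic.qParam 1 (τ : ℂ) ^ n -
        coeff n (𝒮 (℘[D.L] β)) * Function.Periodic.qParam 1 (τ : ℂ) ^ n -
        coeff n (𝒮 (℘[D.L] γ)) * Function.Periodic.qParam 1 (τ : ℂ) ^ n := by
    funext n
    simp only [map_add, map_sub]
    ring
  rw [hfun, show (Fw 0 + Fw α - Fw β - Fw γ) τ = Fw 0 τ + Fw α τ - Fw β τ - Fw γ τ from rfl]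
  exact h

end Summit.BirchSwinnertonDyer.BirchSwinnertonDyer.Theorems.ManinLocalTwoThree.CDivTranslate

end
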